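import Summits.Schanuel.Schanuel.Theorems.ZilberEacLineCurveEscape
import Summits.Schanuel.Schanuel.Theorems.ZilberEacGraphCurveInstances
import HarnessLib

/-!
# Line of NON-REAL slope × arbitrary curve, II: Zariski density and the case certificate

HONEST FRAMING.  Cell `pub-schanuel` (Zilber's Exponential-Algebraic Closedness, case ladder;
host summit Schanuel), seat 2, gen 16.  We answer Mantova–Masser's "unprojected density"
question (PLMS 129 (2024) = arXiv:2303.05592, §1 p. 5; OPEN in general) on the family

  `W(a, b; P) = {x₁ = a x₀ + b} × Z(P) ⊆ ℂ² × ℂ²`, `a ∈ ℂ ∖ ℝ`, `b ∈ ℂ`, `P ∈ ℂ[y₀, y₁]` irreducible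
  with two monomials of different `y₁`-degree (any genus, any singularities).

`unprojectedDense_lineCurveSurface_of_im_ne_zero`: the exponential points are Zariski dense,
`I(W ∩ Γ_exp) = I(W)`.  With seat 1's `unprojectedDense_lineCurveSurface` (REAL irrational slopes,
every irreducible `P` with a torus zero) this gives `unprojectedDense_lineCurveSurface_of_forall_rat_ne`:
EVERY slope `a ∈ ℂ ∖ ℚ`.  The case certificate `mmCase_lineCurveSurfaceC` shows the instances are
not vacuous.  (The remaining fibres over non-real lines — the vertical lines `y₀ = r` — are the
constant-fibre surfaces of `EACDensityTransport.unprojectedDense_line_const_iff`, dense as well;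
the assembly "every irreducible `P`" is `ZilberEacProductSurfaceComplete`.)

This is a modest rung in the case ladder of EAC.  It is NOT Schanuel's conjecture (neither used nor
implied; EAC ⇏ SC); `EC(3,2)` stays OPEN, and so does the density question over base curves that
are not graphs over a coordinate axis.
-/

noncomputable section

open Filter Topology Set Complex MvPolynomial
open Literature.NumberTheory.Transcendental Literature.ModelTheory.Zilber
open Literature.ModelTheory.ExponentialFields

set_option linter.dupNamespace false

namespace Summit.Schanuel.Schanuel.Theorems

section LineC

variable (a b : ℂ) {P : MvPolynomial (Fin 2) ℂ}

/-- **MAIN THEOREM (non-real slopes). Zariski density of the exponential points of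
`{x₁ = a x₀ + b} × Z(P)`** for `Im a ≠ 0` and irreducible `P` with two monomials of different
`y₁`-degree: the solutions of `P(e^z, e^{az+b}) = 0` give a Zariski dense set of points
`(z, az+b, e^z, e^{az+b})` of `W`, `I(W ∩ Γ_exp) = I(W)`.
[cite: MantovaMasser2023, §1 Further remarks, p. 5 (the question, open in general)] (new) -/
theorem unprojectedDense_lineCurveSurface_of_im_ne_zero (ha : a.im ≠ 0) (hirr : Irreducible P)
    (h2 : ∃ v ∈ P.support, ∃ v' ∈ P.support, v 1 ≠ v' 1) :
    UnprojectedDense {w : Fin 2 ⊕ Fin 2 → ℂ | w (Sum.inl 1) = (linePoly a b).eval (w (Sum.inl 0)) ∧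
      MvPolynomial.eval (fun i => w (Sum.inr i)) P = 0} := by
  obtain ⟨z, hz, hgr⟩ := exists_lineCurve_expPoints_of_im_ne_zero a b ha P h2
  exact unprojectedDense_graphCurveSurface_of_expPoints (linePoly a b) P hz hgr
    (isIrreducibleClosed_graphCurveSurface _ hirr) (by rw [zariskiDim_graphCurveSurface _ hirr])

/-- Seat 1's real-slope surface `lineCurveSurface a b P` is the member `p = aX + b` of the family
`{x₁ = p(x₀)} × Z(P)`. -/
theorem lineCurveSurface_eq_setOf (a : ℝ) (b : ℂ) (P : MvPolynomial (Fin 2) ℂ) :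
    lineCurveSurface a b P = {w : Fin 2 ⊕ Fin 2 → ℂ |
      w (Sum.inl 1) = (linePoly (a : ℂ) b).eval (w (Sum.inl 0)) ∧
      MvPolynomial.eval (fun i => w (Sum.inr i)) P = 0} := by
  ext w
  simp [lineCurveSurface, eval_linePoly]

/-- **Every slope `a ∈ ℂ ∖ ℚ`.**  For irreducible `P` with two monomials of different `y₁`-degree
and a zero in `(ℂˣ)²`, the exponential points of `{x₁ = a x₀ + b} × Z(P)` are Zariski dense as
soon as `a ∉ ℚ` (non-real `a`: this file; real irrational `a`: seat 1's
`unprojectedDense_lineCurveSurface`, which needs no condition on the monomials). (new) -/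
theorem unprojectedDense_lineCurveSurface_of_forall_rat_ne (ha : ∀ r : ℚ, a ≠ (r : ℂ))
    (hirr : Irreducible P) (h2 : ∃ v ∈ P.support, ∃ v' ∈ P.support, v 1 ≠ v' 1)
    {c : Fin 2 → ℂ} (h0 : c 0 ≠ 0) (h1 : c 1 ≠ 0) (hc : MvPolynomial.eval c P = 0) :
    UnprojectedDense {w : Fin 2 ⊕ Fin 2 → ℂ | w (Sum.inl 1) = (linePoly a b).eval (w (Sum.inl 0)) ∧
      MvPolynomial.eval (fun i => w (Sum.inr i)) P = 0} := by
  by_cases him : a.im ≠ 0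
  · exact unprojectedDense_lineCurveSurface_of_im_ne_zero a b him hirr h2
  · rw [not_not] at him
    have hare : ((a.re : ℝ) : ℂ) = a := by
      apply Complex.ext <;> simp [him]
    have hirr' : Irrational a.re := by
      rintro ⟨r, hr⟩
      apply ha r
      rw [← hare, ← hr]
      norm_cast
    have h := unprojectedDense_lineCurveSurface_of_zero hirr' b hirr h0 h1 hc
    rwa [lineCurveSurface_eq_setOf, hare] at h

/-- **The closure of the base is not a line of rational slope** (`Im a ≠ 0`, a torus zero of
`P`). (new) -/
theorem not_isRationalSlopeLine_lineCurveSurfaceC (ha : a.im ≠ 0)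
    (hW : ({w : Fin 2 ⊕ Fin 2 → ℂ | w (Sum.inl 1) = (linePoly a b).eval (w (Sum.inl 0)) ∧
        MvPolynomial.eval (fun i => w (Sum.inr i)) P = 0} ∩ torusLocus ℂ 2).Nonempty) :
    ¬ IsRationalSlopeLine (zeroLocus ℂ (vanishingIdeal ℂ
        (projAdd '' ({w : Fin 2 ⊕ Fin 2 → ℂ | w (Sum.inl 1) = (linePoly a b).eval (w (Sum.inl 0)) ∧
          MvPolynomial.eval (fun i => w (Sum.inr i)) P = 0} ∩ torusLocus ℂ 2)))) := by
  rw [projAdd_image_graphCurveSurface_inter_torusLocus (linePoly a b) hW]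
  exact not_isRationalSlopeLine_graphPolySurface _ Polynomial.X_ne_zero fun m₀ m₁ c h =>
    lineCoeffs_eq_zero b ha m₀ m₁ c fun x => by simpa only [eval_linePoly] using h x

/-- **Case certificate (non-real slope).**  For `Im a ≠ 0` and irreducible `P` with a zero in
`(ℂˣ)²`, `{x₁ = a x₀ + b} × Z(P)` satisfies the hypotheses of Mantova–Masser's case
(dim-π-S-1-free). (new) -/
theorem mmCase_lineCurveSurfaceC (ha : a.im ≠ 0) (hirr : Irreducible P)
    (hW : ({w : Fin 2 ⊕ Fin 2 → ℂ | w (Sum.inl 1) = (linePoly a b).eval (w (Sum.inl 0)) ∧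
        MvPolynomial.eval (fun i => w (Sum.inr i)) P = 0} ∩ torusLocus ℂ 2).Nonempty) :
    MMCaseDimPiOneFree {w : Fin 2 ⊕ Fin 2 → ℂ | w (Sum.inl 1) = (linePoly a b).eval (w (Sum.inl 0)) ∧
        MvPolynomial.eval (fun i => w (Sum.inr i)) P = 0} :=
  ⟨isIrreducibleClosed_graphCurveSurface _ hirr, hW, zariskiDim_graphCurveSurface _ hirr,
    addProjDim_graphCurveSurface _ hW, not_isRationalSlopeLine_lineCurveSurfaceC a b ha hW⟩

/-- **Mantova–Masser's question on the family: case ∧ dense** (`Im a ≠ 0`, `P` irreducible with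
two monomials of different `y₁`-degree and a torus zero `c`).
[cite: MantovaMasser2023, §1 Further remarks, p. 5 (the question, open in general)] (new) -/
theorem unprojectedDensityQuestion_instance_lineCurveC (ha : a.im ≠ 0) (hirr : Irreducible P)
    (h2 : ∃ v ∈ P.support, ∃ v' ∈ P.support, v 1 ≠ v' 1)
    {c : Fin 2 → ℂ} (h0 : c 0 ≠ 0) (h1 : c 1 ≠ 0) (hc : MvPolynomial.eval c P = 0) :
    MMCaseDimPiOneFree {w : Fin 2 ⊕ Fin 2 → ℂ |
        w (Sum.inl 1) = (linePoly a b).eval (w (Sum.inl 0)) ∧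
        MvPolynomial.eval (fun i => w (Sum.inr i)) P = 0} ∧
      UnprojectedDense {w : Fin 2 ⊕ Fin 2 → ℂ |
        w (Sum.inl 1) = (linePoly a b).eval (w (Sum.inl 0)) ∧
        MvPolynomial.eval (fun i => w (Sum.inr i)) P = 0} :=
  ⟨mmCase_lineCurveSurfaceC a b ha hirr
      ((graphCurveSurface_inter_torusLocus_nonempty_iff (linePoly a b) P).2 ⟨c, h0, h1, hc⟩),
    unprojectedDense_lineCurveSurface_of_im_ne_zero a b ha hirr h2⟩

end LineC

/-! ## Example -/

/-- **The line of slope `i` × the circle `y₀² + y₁² = 2`.**  The surface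
`{x₁ = i x₀, y₀² + y₁² = 2}` is in Mantova–Masser's case and its exponential points — the solutions of
`e^{2z} + e^{2iz} = 2` — are Zariski dense (torus zero `(1, 1)`). (new) -/
theorem unprojectedDensityQuestion_instance_slopeI_circle :
    MMCaseDimPiOneFree {w : Fin 2 ⊕ Fin 2 → ℂ |
        w (Sum.inl 1) = (linePoly I 0).eval (w (Sum.inl 0)) ∧
        MvPolynomial.eval (fun i => w (Sum.inr i))
          (MvPolynomial.X 0 ^ 2 + MvPolynomial.X 1 ^ 2 - MvPolynomial.C 2 : MvPolynomial (Fin 2) ℂ) = 0} ∧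
      UnprojectedDense {w : Fin 2 ⊕ Fin 2 → ℂ |
        w (Sum.inl 1) = (linePoly I 0).eval (w (Sum.inl 0)) ∧
        MvPolynomial.eval (fun i => w (Sum.inr i))
          (MvPolynomial.X 0 ^ 2 + MvPolynomial.X 1 ^ 2 - MvPolynomial.C 2 : MvPolynomial (Fin 2) ℂ) = 0} := by
  have h0 : (![1, 1] : Fin 2 → ℂ) 0 ≠ 0 := by simp
  have h1 : (![1, 1] : Fin 2 → ℂ) 1 ≠ 0 := by simp
  have hc : MvPolynomial.eval (![1, 1] : Fin 2 → ℂ)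
      (MvPolynomial.X 0 ^ 2 + MvPolynomial.X 1 ^ 2 - MvPolynomial.C 2 : MvPolynomial (Fin 2) ℂ) = 0 := by
    norm_num
  exact unprojectedDensityQuestion_instance_lineCurveC I 0 (by simp)
    (irreducible_circlePoly two_ne_zero) (circlePoly_support_pair two_ne_zero) h0 h1 hc

end Summit.Schanuel.Schanuel.Theorems
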